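import Mathlib.Analysis.SpecialFunctions.Pow.Real
import Mathlib.Analysis.SpecialFunctions.Pow.Complex
import Mathlib.Analysis.Calculus.Deriv.Basic
import Literature.Geometry.Lorentzian.CoordCurvature
import HarnessLib

/-!
# Smooth unstable modes of a self-similar vacuum profile

The linearised Einstein vacuum operator about a (continuously or discretely) self-similar
Ricci-flat metric, written in coordinates adapted to the homothety, and the predicate
`HasSmoothUnstableMode` — "the linearised operator in self-similar time `s = -log(T - t)` has an
eigenvalue `μ` with `Re μ > 0` whose eigentensor is regular (of a prescribed class) across the past
light cone of the vertex and is not pure gauge" — requested by route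
`FinalStateConjecture/TangentProfileCensorship` (item `SmoothProfileInstability`) as definition D4.

Everything is chart-level, in the coordinate tensor calculus of `CoordCurvature.lean`: the datum
is a field of metric components `Z : E → (E →L[ℝ] E →L[ℝ] ℝ)` on a finite-dimensional real normed
space `E` (for the route, `E = E4`), the vertex of the self-similar profile sits at the origin
and the homothety acts by the dilations `x ↦ c • x`. In such **homothety-adapted coordinates** a
spacetime is continuously self-similar (CSS: it carries a homothetic vector field `K`,
`ℒ_K g = 2 g`, here `K = x^μ ∂_μ`) iff its components are dilation invariant,
`Z (c • x) = Z x` for all `c > 0`, and discretely self-similar (DSS, echoing period `Δ`) iff this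
holds for the single scale `c = e^{-Δ}` (Gundlach–Martín-García, Living Rev. Relativ. 10 (2007) 5,
§2.2, eqs. `ℒ_ξ g_{ab} = 2 g_{ab}`, `g_{μν}(τ, xⁱ) = e^{-2τ} g̃_{μν}(xⁱ)` resp. `g̃` periodic in `τ`).
We therefore carry the set of admissible scale factors as a parameter `scales : Set ℝ`
(`Set.Ioi 0` for CSS, `{Real.exp (-Δ)}` for DSS).

## Contents

* `MetricCoord.lieDerivAt Z ξ x` — the Lie derivative `ℒ_ξ Z` of the components along a vector
  field `ξ : E → E`: `(ℒ_ξ Z)_x(v, w) = (D_{ξ(x)} Z)(v, w) + Z_x(Dξ(x) v, w) + Z_x(v, Dξ(x) w)`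
  (Besse 1987, proof of Thm. 1.81: `(L_X g)(Y,Z) = X·g(Y,Z) − g([X,Y],Z) − g(Y,[X,Z])`, on the
  constant fields `Y = v`, `Z = w`, where `[ξ, v] = −Dξ(v)`).
* `MetricCoord.linRicAt Z h x` — the **linearised Ricci operator** `Ric'_Z(h)` at `x`: the
  derivative at `ε = 0` of `ε ↦ Ric(Z + ε h)(x)` (Besse 1987, 1.173–1.174: the differential `r'_g`
  of the quasilinear second-order operator `g ↦ r_g`; formula 1.174 (d)
  `r'_g h = ½ Δ_L h − δ*_g(δ_g h) − ½ D_g d(tr_g h)`). The linearised Einstein VACUUM equations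
  about a Ricci-flat `Z` are `Ric'_Z(h) = 0` (equivalently the linearised Einstein tensor vanishes,
  by trace reversal, `dim ≠ 2`).
* `MetricCoord.IsModeSolution Z scales U n μ h₁ h₂` — a **mode solution with exponent `μ ∈ ℂ`**
  of regularity `C^n` on the region `U`: the complex symmetric `2`-tensor field `h = h₁ + i h₂`
  solves `Ric'_Z(h) = 0` on `U`, is `C^n` on `U`, and is homogeneous of degree `−μ` under the
  admissible dilations, `h(c • x) = c^{−μ} h(x)`. In similarity coordinates
  `s = −log(−t)`, `y = x'/(−t)` (vertex at the origin, `t = x⁰ < 0`) this is exactly the mode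
  ansatz `h = e^{μ s} H(y)` of the blow-up literature (Costin–Donninger–Glogić, CMP 351 (2016),
  §2.2: `φ(τ,ρ) = f(ρ) + e^{λτ} u_λ(ρ)`; Donninger–Moscatelli, arXiv:2601.19515, §2.2, eq.
  `φ(τ,ξ) = e^{λτ} f(ξ)` with `f ∈ C^∞(B̄^d)`; Gundlach–Martín-García 2007, §2.3,
  `Z(x,τ) ≃ Z_*(x) + Σ Cᵢ e^{λᵢτ} Zᵢ(x)`): indeed `e^{μs} H(x'/(−t)) = (−t)^{−μ} H(x'/(−t))` is
  homogeneous of degree `−μ` in `(t, x')`, and conversely. For a DSS background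
  (`scales = {e^{-Δ}}`) the linearised operator is `Δ`-periodic in `s` and `μ` is a Floquet
  exponent. `Re μ > 0` means growth, relative to the (degree-`0`) background, towards the vertex.
* `MetricCoord.IsPureGaugeOn Z U h` — `h = ℒ_ξ Z` on `U` for some `C¹` vector field `ξ` (an
  infinitesimal diffeomorphism: the tangent space to the orbit of `g` under the diffeomorphism
  group consists of the Lie derivatives `L_X g`, Besse 1987, 12.21; `L_X Ric(g) = Ric'_g(L_X g)`,
  ibid. §5.C, so at a Ricci-flat `Z` every pure-gauge tensor solves the linearised equations).
* `HasSmoothUnstableMode Z scales U n` — **there is an exponent `μ` with `0 < Re μ` and a `C^n`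
  mode solution with exponent `μ` on `U` which is not pure gauge.**

## Design choices (what the requester asked for, and what is deliberately not here)

* *Gauge.* The request speaks of "a fixed gauge adapted to the homothety (generalised harmonic or
  double null)" and of eigentensors that are "neither pure gauge nor a symmetry mode". We use the
  gauge-INDEPENDENT formulation — solutions of the full linearised vacuum equations modulo
  `ℒ_ξ Z` — which is what a physical (in)stability statement means in any gauge, and which needs
  no gauge-fixed reduced operator (the tree has none). In vacuum the **symmetry modes are pure
  gauge**: the generators of translations (`ξ` constant: `ℒ_ξ Z = D_a Z`, exponent `μ = 1`, the
  analogue of the symmetry eigenvalue `λ = 1` of Costin–Donninger–Glogić §2.2), of Lorentz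
  transformations and of the scaling (`ξ = id`, `ℒ_ξ Z = D_x Z(x) + 2 Z`, exponent `0`) are Lie
  derivatives along smooth vector fields (`MetricCoord.isPureGaugeOn_fderiv_apply`,
  `MetricCoord.isPureGaugeOn_scaling`), so "modulo gauge" subsumes "modulo symmetry modes" here —
  unlike for semilinear models without gauge freedom (wave maps), where the symmetry modes must
  be removed by hand (Donninger–Moscatelli 2026, Def. 2.1).
* *Regularity across the cone is a parameter.* `n : ℕ∞ω` is the differentiability class of the
  MODE on `U`; the intended `U` is an open dilation-invariant region of the past of the vertex
  containing a neighbourhood of the (regular) past light cone of the vertex minus the vertex, so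
  `C^n` on `U` means `C^n` ACROSS the cone — the boundary condition that makes the mode problem a
  genuine spectral problem (Costin–Donninger–Glogić §2.2: "admissible solutions … belong to
  `C^∞[0,1]`", i.e. up to and including the light cone `ρ = 1`; Donninger–Moscatelli §2.2,
  `f ∈ C^∞(B̄^d)`). The smooth class is `n = ∞` (or `ω`); at threshold regularity of
  `k`-self-similar naked singularities the relevant class is `C^{1, k²/(1−k²)}` (Singh–Zheng,
  arXiv:2605.16095, where the ABSENCE of growing modes is proved in that class), which sits
  between `n = 1` and `n = 2` here. Gauge vector fields are taken merely `C¹` on `U`,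
  independently of `n`, so that `HasSmoothUnstableMode` is antitone in `n`
  (`HasSmoothUnstableMode.of_le`) and "not pure gauge" is the strongest (most conservative)
  reading.
* *No weighted function space.* For a homogeneous field, membership in the weighted smooth /
  Sobolev spaces in the similarity variable `y` used by Merle–Raphaël–Rodnianski–Szeftel-type
  analyses is equivalent to local `C^n` (resp. `H^n_loc`) regularity on the cone region in the
  physical variables (`|y| → ∞` is the punctured slice `{t = 0, x' ≠ 0}`, which the user may or may
  not include in `U`); so the only analytic parameter is `n` (and `U`).
* *Homogeneity is imposed only inside `U`*: the clause `c • x ∈ U →` makes the predicate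
  independent of the (junk) values of `h` off `U`; `U` is meant to be invariant under the
  admissible dilations and `scales ⊆ (0, ∞)`.
* *Not here:* the background notions (CSS/DSS vacuum PROFILE as a spacetime with homothety,
  vertex, regular past cone — definition item `SelfSimilarVacuumProfile`), Ricci-flatness of `Z`
  and its self-similarity are NOT hypotheses of `HasSmoothUnstableMode` (they are asserted about
  `Z` separately by the user; the predicate is meaningful for any `C²` component field); no claim
  that any particular profile has or lacks such a mode is made (no named fact is introduced).
  The identification of `linRicAt` with the trace of `varRiemAt` of `CoordMetricVariation.lean`
  for the family `ε ↦ Z + ε h` is left to users (it is `hasDerivWithinAt_ricAt_apply` there).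

## References

* A. L. Besse, *Einstein manifolds*, Springer 1987: Thm. 1.81 (proof; Lie derivative of `g`),
  1.173–1.174 (differential of `Ric`), §5.C after (5.15) (`L_X Ric(g) = Ric'(g)(L_X g)`), 12.21
  (tangent space of the diffeomorphism orbit). [Besse1987]
* C. Gundlach, J. M. Martín-García, *Critical phenomena in gravitational collapse*, Living Rev.
  Relativ. 10 (2007) 5 = arXiv:0711.4620, §2.2 (CSS/DSS, adapted coordinates), §2.3
  (perturbation modes `e^{λᵢτ} Zᵢ`, one growing mode of a critical solution).
  [GundlachMartingarcia2007]
* O. Costin, R. Donninger, I. Glogić, *Mode stability of self-similar wave maps in higher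
  dimensions*, CMP 351 (2016) 959 = arXiv:1604.00303, §2.2 and Def. 2.1. [CostinDonningerGlogic2016]
* R. Donninger, F. Moscatelli, *Mode stability of self-similar wave maps without symmetry in
  higher dimensions*, arXiv:2601.19515, §2.1–2.2, Def. 2.1. [DonningerMoscatelli2026]
* F. Merle, P. Raphaël, I. Rodnianski, J. Szeftel, Ann. of Math. 196 (2022) (finite-codimension
  stability of smooth self-similar profiles; the smooth-class template). [MerleEtAl2022]
-/

noncomputable section

-- instance search on the nested operator spaces `E →L[ℝ] E →L[ℝ] E →L[ℝ] ℝ` needs a deeper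
-- pending depth, as in `CoordCurvature.lean`
set_option maxSynthPendingDepth 3

open Set Filter ContinuousLinearMap
open scoped Topology ContDiff

namespace Literature.Geometry.Lorentzian

namespace MetricCoord

variable {E : Type*} [NormedAddCommGroup E] [NormedSpace ℝ E]

/-! ### The Lie derivative of the metric components along a vector field -/

section LieDeriv

variable (Z : E → E →L[ℝ] E →L[ℝ] ℝ)

/-- The **Lie derivative of the metric components** `Z` along the vector field `ξ : E → E`
(components in the same chart), at `x`:
`(ℒ_ξ Z)_x (v, w) = (D_{ξ x} Z)(v, w) + Z_x (Dξ_x v, w) + Z_x (v, Dξ_x w)`, i.e.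
`(ℒ_ξ g)_{μν} = ξ^α ∂_α g_{μν} + g_{αν} ∂_μ ξ^α + g_{μα} ∂_ν ξ^α`. This is Besse's
`(L_X g)(Y, Z) = X · g(Y, Z) − g([X, Y], Z) − g(Y, [X, Z])` (proof of Thm. 1.81) on the constant
fields `Y = v`, `Z = w`, for which `[ξ, v] = −Dξ(v)`. Total (Fréchet derivatives `fderiv`, junk `0`
where `Z` or `ξ` is not differentiable). [cite: Besse1987, Thm. 1.81 (proof)] -/
def lieDerivAt (ξ : E → E) (x : E) : E →L[ℝ] E →L[ℝ] ℝ :=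
  fderiv ℝ Z x (ξ x) + (Z x).comp (fderiv ℝ ξ x) + ((Z x).flip.comp (fderiv ℝ ξ x)).flip

/-- Unfolding lemma: `(ℒ_ξ Z)_x (v, w) = DZ_x(ξ x)(v, w) + Z_x(Dξ_x v, w) + Z_x(v, Dξ_x w)`.
[cite: Besse1987, Thm. 1.81 (proof)] -/
@[simp]
theorem lieDerivAt_apply (ξ : E → E) (x v w : E) :
    lieDerivAt Z ξ x v w =
      fderiv ℝ Z x (ξ x) v w + Z x (fderiv ℝ ξ x v) w + Z x v (fderiv ℝ ξ x w) := by
  simp [lieDerivAt]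

/-- `ℒ_0 Z = 0`. [folklore] -/
@[simp]
theorem lieDerivAt_zero (x : E) : lieDerivAt Z 0 x = 0 := by
  ext v w
  simp

/-- **Translation modes are Lie derivatives**: along a constant field `ξ ≡ a` (the generator of
the translations in the direction `a`), `ℒ_a Z = D_a Z`, the derivative of the components.
[cite: Besse1987, Thm. 1.81 (proof)] -/
theorem lieDerivAt_const (a x : E) : lieDerivAt Z (fun _ ↦ a) x = fderiv ℝ Z x a := by
  ext v w
  simp

/-- **The scaling mode is a Lie derivative**: along the generator `ξ = id` (`K = x^μ ∂_μ`) of the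
dilations, `ℒ_K Z = D_x Z(x) + 2 Z(x)`; for dilation-invariant (CSS) components the first term
vanishes and `ℒ_K Z = 2 Z` is the homothetic Killing equation. [cite: GundlachMartingarcia2007, §2.2] -/
theorem lieDerivAt_id (x : E) : lieDerivAt Z id x = fderiv ℝ Z x x + 2 • Z x := by
  ext v w
  simp [two_smul]
  ring

/-- Along a continuous linear field `ξ = A` (generators of rotations and boosts, `A` in the
Lorentz Lie algebra; of dilations, `A = id`): `(ℒ_A Z)_x(v,w) = DZ_x(A x)(v,w) + Z_x(A v, w) + Z_x(v, A w)`.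
[cite: Besse1987, Thm. 1.81 (proof)] -/
theorem lieDerivAt_clm_apply (A : E →L[ℝ] E) (x v w : E) :
    lieDerivAt Z A x v w = fderiv ℝ Z x (A x) v w + Z x (A v) w + Z x v (A w) := by
  simp

end LieDeriv

/-! ### The linearised Ricci operator -/

section LinRic

variable [FiniteDimensional ℝ E] (Z : E → E →L[ℝ] E →L[ℝ] ℝ)

/-- The **linearised Ricci operator** of the components `Z` in the direction `h`, at `x`:
`Ric'_Z(h)(x) = d/dε|_{ε=0} Ric(Z + ε h)(x)`, the differential at `Z` of the quasilinear
second-order operator `g ↦ Ric(g)` (`MetricCoord.ricAt`), Besse 1987, 1.173–1.174 (with the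
formula `r'_g h = ½ Δ_L h − δ*_g(δ_g h) − ½ D_g d(tr_g h)`, Thm. 1.174 (d)). The linearised
Einstein vacuum equations about a Ricci-flat `Z` read `Ric'_Z(h) = 0`. Defined with Mathlib's
`deriv` (junk `0` if `ε ↦ Ric(Z + εh)(x)` is not differentiable at `0`; it is whenever `Z x` is
nondegenerate and `Z`, `h` are `C²` near `x`, `Ric(Z + εh)(x)` being a rational function of `ε`
and the `2`-jets of `Z`, `h` at `x`, cf. `CoordRicciJet.lean`). [cite: Besse1987, Thm. 1.174 (d)] -/
def linRicAt (h : E → E →L[ℝ] E →L[ℝ] ℝ) (x : E) : E →L[ℝ] E →L[ℝ] ℝ :=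
  deriv (fun ε : ℝ ↦ ricAt (Z + ε • h) x) 0

/-- Unfolding lemma for `linRicAt`. [cite: Besse1987, Thm. 1.174 (d)] -/
theorem linRicAt_def (h : E → E →L[ℝ] E →L[ℝ] ℝ) (x : E) :
    linRicAt Z h x = deriv (fun ε : ℝ ↦ ricAt (Z + ε • h) x) 0 := rfl

/-- `Ric'_Z(0) = 0`. [folklore] -/
@[simp]
theorem linRicAt_zero (x : E) : linRicAt Z 0 x = 0 := by
  simp [linRicAt]

end LinRic

/-! ### Pure gauge tensors -/

section Gauge

/-- A (real) symmetric `2`-tensor field `h` is **pure gauge** on `U` for the background `Z` if it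
is the Lie derivative `h = ℒ_ξ Z` on `U` of `Z` along some vector field `ξ` of class `C¹` on `U`
(an infinitesimal diffeomorphism: the tangent space at `g` to the orbit of `g` under the
diffeomorphism group consists of the `L_X g`, Besse 1987, 12.21; and `L_X Ric(g) = Ric'_g(L_X g)`,
ibid. §5.C, so at a Ricci-flat background pure-gauge tensors solve the linearised vacuum
equations). The regularity `C¹` of `ξ` is the least for which `ℒ_ξ Z` is classical, making
"not pure gauge" as strong as possible. [cite: Besse1987, 12.21] -/
def IsPureGaugeOn (Z : E → E →L[ℝ] E →L[ℝ] ℝ) (U : Set E) (h : E → E →L[ℝ] E →L[ℝ] ℝ) : Prop :=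
  ∃ ξ : E → E, ContDiffOn ℝ 1 ξ U ∧ ∀ x ∈ U, h x = lieDerivAt Z ξ x

/-- The zero tensor is pure gauge (`ξ = 0`). [folklore] -/
theorem IsPureGaugeOn.zero (Z : E → E →L[ℝ] E →L[ℝ] ℝ) (U : Set E) : IsPureGaugeOn Z U 0 :=
  ⟨0, contDiffOn_const, fun x _ ↦ by simp⟩

/-- **Translation modes are pure gauge**: the derivative `x ↦ D_a Z(x)` of the components in a
fixed direction `a` (the linearisation of the translated backgrounds `Z(· + δ a)`; for a CSS
background it is homogeneous of degree `−1`, i.e. it is the symmetry mode with exponent `μ = 1`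
of Costin–Donninger–Glogić 2016, §2.2) is `ℒ_a Z` along the constant field `a`.
[cite: CostinDonningerGlogic2016, §2.2] -/
theorem isPureGaugeOn_fderiv_apply (Z : E → E →L[ℝ] E →L[ℝ] ℝ) (U : Set E) (a : E) :
    IsPureGaugeOn Z U fun x ↦ fderiv ℝ Z x a :=
  ⟨fun _ ↦ a, contDiffOn_const, fun x _ ↦ (lieDerivAt_const Z a x).symm⟩

/-- **Linear symmetry generators give pure gauge modes**: for a continuous linear field `A`
(infinitesimal rotation, boost or dilation) the tensor `x ↦ ℒ_A Z (x)` is pure gauge.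
[cite: DonningerMoscatelli2026, §2.2] -/
theorem isPureGaugeOn_lieDerivAt_clm (Z : E → E →L[ℝ] E →L[ℝ] ℝ) (U : Set E) (A : E →L[ℝ] E) :
    IsPureGaugeOn Z U (lieDerivAt Z A) :=
  ⟨A, A.contDiff.contDiffOn, fun _ _ ↦ rfl⟩

/-- **The scaling mode is pure gauge**: `x ↦ D_x Z(x) + 2 Z(x) = ℒ_{id} Z (x)` (for a CSS background
this is `2 Z`, the homothetic Killing equation `ℒ_K g = 2 g`). [cite: GundlachMartingarcia2007, §2.2] -/
theorem isPureGaugeOn_scaling (Z : E → E →L[ℝ] E →L[ℝ] ℝ) (U : Set E) :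
    IsPureGaugeOn Z U fun x ↦ fderiv ℝ Z x x + 2 • Z x :=
  ⟨id, contDiff_id.contDiffOn, fun x _ ↦ (lieDerivAt_id Z x).symm⟩

/-- On the empty region every tensor is pure gauge. [folklore] -/
theorem isPureGaugeOn_empty (Z : E → E →L[ℝ] E →L[ℝ] ℝ) (h : E → E →L[ℝ] E →L[ℝ] ℝ) :
    IsPureGaugeOn Z ∅ h :=
  ⟨0, contDiffOn_const, fun _ hx ↦ hx.elim⟩

end Gauge

/-! ### Mode solutions -/

section Modes

variable [FiniteDimensional ℝ E]

/-- A **mode solution with exponent `μ`**, of class `C^n` on the region `U`, of the linearised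
Einstein vacuum equations about the components `Z`, for the admissible scale factors `scales`
(`Set.Ioi 0` for a continuously self-similar background, `{e^{-Δ}}` for a discretely
self-similar one of period `Δ`): a complex symmetric `2`-tensor field `h = h₁ + i h₂` (real and
imaginary parts `h₁ h₂ : E → E →L[ℝ] E →L[ℝ] ℝ`) which is `C^n` on `U` — `U` is meant to be an
open, dilation-invariant region of the past of the vertex `0` containing the past light cone of
the vertex, so this is regularity ACROSS the cone —, solves `Ric'_Z(h₁) = Ric'_Z(h₂) = 0` on `U`,
and is **homogeneous of degree `−μ`** under the admissible dilations inside `U`: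
`h(c • x) = c^{−μ} h(x)`. In similarity coordinates `s = −log(−t)`, `y = x'/(−t)` this is the
mode ansatz `h = e^{μ s} H(y)` (Costin–Donninger–Glogić 2016, §2.2; Donninger–Moscatelli 2026,
§2.2, with `f ∈ C^∞` up to and including the light cone; Gundlach–Martín-García 2007, §2.3), and
for `scales = {e^{-Δ}}` the exponent `μ` is a Floquet exponent of the `Δ`-periodic linearised
operator. `Re μ > 0` = growth relative to the degree-`0` background towards the vertex.
[cite: CostinDonningerGlogic2016, §2.2] [cite: DonningerMoscatelli2026, §2.2]
[cite: GundlachMartingarcia2007, §2.3] -/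
structure IsModeSolution (Z : E → E →L[ℝ] E →L[ℝ] ℝ) (scales : Set ℝ) (U : Set E) (n : ℕ∞ω)
    (μ : ℂ) (h₁ h₂ : E → E →L[ℝ] E →L[ℝ] ℝ) : Prop where
  contDiffOn_re : ContDiffOn ℝ n h₁ U
  contDiffOn_im : ContDiffOn ℝ n h₂ U
  symm_re : ∀ x ∈ U, ∀ v w : E, h₁ x v w = h₁ x w v
  symm_im : ∀ x ∈ U, ∀ v w : E, h₂ x v w = h₂ x w v
  linRicAt_re : ∀ x ∈ U, linRicAt Z h₁ x = 0
  linRicAt_im : ∀ x ∈ U, linRicAt Z h₂ x = 0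
  homogeneous : ∀ c ∈ scales, ∀ x ∈ U, c • x ∈ U → ∀ v w : E,
    (⟨h₁ (c • x) v w, h₂ (c • x) v w⟩ : ℂ) = (c : ℂ) ^ (-μ) * ⟨h₁ x v w, h₂ x v w⟩

variable {Z : E → E →L[ℝ] E →L[ℝ] ℝ} {scales scales' : Set ℝ} {U : Set E} {n n' : ℕ∞ω} {μ : ℂ}
  {h₁ h₂ : E → E →L[ℝ] E →L[ℝ] ℝ}

/-- The zero tensor is a (trivial) mode solution for every exponent. [folklore] -/
theorem IsModeSolution.zero (Z : E → E →L[ℝ] E →L[ℝ] ℝ) (scales : Set ℝ) (U : Set E) (n : ℕ∞ω)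
    (μ : ℂ) : IsModeSolution Z scales U n μ 0 0 where
  contDiffOn_re := contDiffOn_const
  contDiffOn_im := contDiffOn_const
  symm_re := fun _ _ _ _ ↦ rfl
  symm_im := fun _ _ _ _ ↦ rfl
  linRicAt_re := fun x _ ↦ linRicAt_zero Z x
  linRicAt_im := fun x _ ↦ linRicAt_zero Z x
  homogeneous := fun c _ x _ _ v w ↦ by simp [Complex.ext_iff]

/-- Mode solutions of class `C^{n'}` are mode solutions of every class `n ≤ n'`. [folklore] -/
theorem IsModeSolution.of_le (hm : IsModeSolution Z scales U n' μ h₁ h₂) (hn : n ≤ n') :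
    IsModeSolution Z scales U n μ h₁ h₂ where
  contDiffOn_re := hm.contDiffOn_re.of_le hn
  contDiffOn_im := hm.contDiffOn_im.of_le hn
  symm_re := hm.symm_re
  symm_im := hm.symm_im
  linRicAt_re := hm.linRicAt_re
  linRicAt_im := hm.linRicAt_im
  homogeneous := hm.homogeneous

/-- Fewer admissible scale factors, fewer homogeneity constraints: a mode for `scales'` is a mode
for every `scales ⊆ scales'` (e.g. a CSS mode, `scales' = Set.Ioi 0`, is a DSS/Floquet mode for
every single scale factor). [folklore] -/
theorem IsModeSolution.anti (hm : IsModeSolution Z scales' U n μ h₁ h₂) (hs : scales ⊆ scales') :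
    IsModeSolution Z scales U n μ h₁ h₂ where
  contDiffOn_re := hm.contDiffOn_re
  contDiffOn_im := hm.contDiffOn_im
  symm_re := hm.symm_re
  symm_im := hm.symm_im
  linRicAt_re := hm.linRicAt_re
  linRicAt_im := hm.linRicAt_im
  homogeneous := fun c hc ↦ hm.homogeneous c (hs hc)

/-- **Real modes.** For a real exponent `μ` and positive scale factors, a real symmetric field `h`
of class `C^n` on `U` solving `Ric'_Z(h) = 0` on `U` and homogeneous of degree `−μ`,
`h(c • x) = c^{−μ} h(x)`, is a mode solution (with zero imaginary part). [folklore] -/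
theorem IsModeSolution.of_real {μ : ℝ} {h : E → E →L[ℝ] E →L[ℝ] ℝ} (hpos : scales ⊆ Set.Ioi 0)
    (hn : ContDiffOn ℝ n h U) (hsymm : ∀ x ∈ U, ∀ v w : E, h x v w = h x w v)
    (hlin : ∀ x ∈ U, linRicAt Z h x = 0)
    (hhom : ∀ c ∈ scales, ∀ x ∈ U, c • x ∈ U → h (c • x) = (c ^ (-μ)) • h x) :
    IsModeSolution Z scales U n (μ : ℂ) h 0 where
  contDiffOn_re := hn
  contDiffOn_im := contDiffOn_const
  symm_re := hsymm
  symm_im := fun _ _ _ _ ↦ rfl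
  linRicAt_re := hlin
  linRicAt_im := fun x _ ↦ linRicAt_zero Z x
  homogeneous := fun c hc x hx hcx v w ↦ by
    have hc0 : (0 : ℝ) ≤ c := le_of_lt (hpos hc)
    have hpow : ((c : ℂ) ^ (-(μ : ℂ))) = ((c ^ (-μ) : ℝ) : ℂ) := by
      rw [Complex.ofReal_cpow hc0 (-μ)]
      push_cast
      rfl
    rw [hhom c hc x hx hcx, hpow]
    apply Complex.ext <;> simp

end Modes

end MetricCoord

/-! ### The predicate requested by route `TangentProfileCensorship` -/

section Main

variable {E : Type*} [NormedAddCommGroup E] [NormedSpace ℝ E] [FiniteDimensional ℝ E]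

/-- **Smooth unstable mode of a self-similar vacuum profile** (definition D4 of route
`FinalStateConjecture/TangentProfileCensorship`; no printed vacuum formulation exists, the
templates being Costin–Donninger–Glogić 2016, §2.2 / Donninger–Moscatelli 2026, Def. 2.1 (mode
solutions `e^{λτ} f`, `f` smooth up to and across the light cone, unstable = `Re λ > 0`, modulo
symmetry modes) and the finite-codimension picture of Gundlach–Martín-García 2007, §2.3 and
Merle–Raphaël–Rodnianski–Szeftel 2022). For the components `Z` of a background metric in
homothety-adapted coordinates (vertex at `0`, admissible scale factors `scales`: `Set.Ioi 0` for
a CSS profile, `{Real.exp (-Δ)}` for a DSS profile of period `Δ`), a region `U` (open, dilation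
invariant, containing the past light cone of the vertex minus the vertex) and a regularity class
`n : ℕ∞ω` ACROSS that cone (the smooth class is `n = ∞`): **the linearised Einstein vacuum
operator about `Z` in self-similar time `s = −log(−t)` has an eigenvalue (Floquet exponent in the
DSS case) `μ` with `Re μ > 0` admitting an eigentensor of class `C^n` across the cone which is
not pure gauge** — i.e. there are `μ : ℂ` with `0 < Re μ` and a `C^n` mode solution
`h₁ + i h₂` with exponent `μ` on `U` (`MetricCoord.IsModeSolution`: solves `Ric'_Z = 0`,
homogeneous of degree `−μ`) whose real and imaginary parts are not both Lie derivatives `ℒ_ξ Z`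
of `C¹` vector fields (`MetricCoord.IsPureGaugeOn`). In vacuum the symmetry modes (translations,
Lorentz transformations, scaling applied to `Z`) are pure gauge
(`MetricCoord.isPureGaugeOn_fderiv_apply`, `MetricCoord.isPureGaugeOn_lieDerivAt_clm`), so
quotienting by gauge also removes them. Ricci-flatness and self-similarity of `Z` are asserted
separately by the user (notion `SelfSimilarVacuumProfile`); the predicate is antitone in `n`
(`HasSmoothUnstableMode.of_le`) and in `scales` (`HasSmoothUnstableMode.anti`).
[cite: CostinDonningerGlogic2016, §2.2, Def. 2.1] [cite: DonningerMoscatelli2026, Def. 2.1]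
[cite: GundlachMartingarcia2007, §2.3] -/
def HasSmoothUnstableMode (Z : E → E →L[ℝ] E →L[ℝ] ℝ) (scales : Set ℝ) (U : Set E)
    (n : ℕ∞ω) : Prop :=
  ∃ μ : ℂ, 0 < μ.re ∧ ∃ h₁ h₂ : E → E →L[ℝ] E →L[ℝ] ℝ,
    MetricCoord.IsModeSolution Z scales U n μ h₁ h₂ ∧
      ¬ (MetricCoord.IsPureGaugeOn Z U h₁ ∧ MetricCoord.IsPureGaugeOn Z U h₂)

variable {Z : E → E →L[ℝ] E →L[ℝ] ℝ} {scales scales' : Set ℝ} {U : Set E} {n n' : ℕ∞ω}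

/-- Unfolding lemma for `HasSmoothUnstableMode`. [folklore] -/
theorem hasSmoothUnstableMode_iff :
    HasSmoothUnstableMode Z scales U n ↔
      ∃ μ : ℂ, 0 < μ.re ∧ ∃ h₁ h₂ : E → E →L[ℝ] E →L[ℝ] ℝ,
        MetricCoord.IsModeSolution Z scales U n μ h₁ h₂ ∧
          ¬ (MetricCoord.IsPureGaugeOn Z U h₁ ∧ MetricCoord.IsPureGaugeOn Z U h₂) :=
  Iff.rfl

/-- **Antitone in the regularity class**: an unstable mode of class `C^{n'}` is one of every class
`n ≤ n'` (lower regularity admits more modes — the mechanism behind the regularity dependence of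
naked-singularity (in)stability). [folklore] -/
theorem HasSmoothUnstableMode.of_le (h : HasSmoothUnstableMode Z scales U n') (hn : n ≤ n') :
    HasSmoothUnstableMode Z scales U n := by
  obtain ⟨μ, hμ, h₁, h₂, hm, hg⟩ := h
  exact ⟨μ, hμ, h₁, h₂, hm.of_le hn, hg⟩

/-- **Antitone in the scale set**: an unstable mode for `scales'` is one for every
`scales ⊆ scales'` (a CSS-unstable profile is Floquet-unstable for each single scale factor).
[folklore] -/
theorem HasSmoothUnstableMode.anti (h : HasSmoothUnstableMode Z scales' U n) (hs : scales ⊆ scales') :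
    HasSmoothUnstableMode Z scales U n := by
  obtain ⟨μ, hμ, h₁, h₂, hm, hg⟩ := h
  exact ⟨μ, hμ, h₁, h₂, hm.anti hs, hg⟩

/-- A sufficient **real** criterion: a real exponent `μ > 0`, positive scale factors, and a real
`C^n` symmetric solution of `Ric'_Z(h) = 0` on `U`, homogeneous of degree `−μ` and not pure
gauge, give a smooth unstable mode. [folklore] -/
theorem hasSmoothUnstableMode_of_real {μ : ℝ} {h : E → E →L[ℝ] E →L[ℝ] ℝ} (hμ : 0 < μ)
    (hpos : scales ⊆ Set.Ioi 0) (hn : ContDiffOn ℝ n h U)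
    (hsymm : ∀ x ∈ U, ∀ v w : E, h x v w = h x w v)
    (hlin : ∀ x ∈ U, MetricCoord.linRicAt Z h x = 0)
    (hhom : ∀ c ∈ scales, ∀ x ∈ U, c • x ∈ U → h (c • x) = (c ^ (-μ)) • h x)
    (hng : ¬ MetricCoord.IsPureGaugeOn Z U h) :
    HasSmoothUnstableMode Z scales U n :=
  ⟨μ, by simpa using hμ, h, 0, MetricCoord.IsModeSolution.of_real hpos hn hsymm hlin hhom,
    fun hg ↦ hng hg.1⟩

/-- An unstable mode is somewhere nonzero on `U` (the zero tensor is pure gauge). [folklore] -/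
theorem HasSmoothUnstableMode.exists_ne_zero (h : HasSmoothUnstableMode Z scales U n) :
    ∃ μ : ℂ, 0 < μ.re ∧ ∃ h₁ h₂ : E → E →L[ℝ] E →L[ℝ] ℝ,
      MetricCoord.IsModeSolution Z scales U n μ h₁ h₂ ∧ ∃ x ∈ U, h₁ x ≠ 0 ∨ h₂ x ≠ 0 := by
  obtain ⟨μ, hμ, h₁, h₂, hm, hg⟩ := h
  refine ⟨μ, hμ, h₁, h₂, hm, ?_⟩
  by_contra hzero
  refine hg ⟨⟨0, contDiffOn_const, fun x hx ↦ ?_⟩, ⟨0, contDiffOn_const, fun x hx ↦ ?_⟩⟩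
  · have h0 : h₁ x = 0 := Classical.byContradiction fun hne ↦ hzero ⟨x, hx, Or.inl hne⟩
    rw [h0, MetricCoord.lieDerivAt_zero]
  · have h0 : h₂ x = 0 := Classical.byContradiction fun hne ↦ hzero ⟨x, hx, Or.inr hne⟩
    rw [h0, MetricCoord.lieDerivAt_zero]

/-- On the empty region there is no unstable mode (everything is pure gauge): the predicate is not
vacuously true. [folklore] -/
theorem not_hasSmoothUnstableMode_empty (Z : E → E →L[ℝ] E →L[ℝ] ℝ) (scales : Set ℝ) (n : ℕ∞ω) :
    ¬ HasSmoothUnstableMode Z scales ∅ n := by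
  rintro ⟨μ, -, h₁, h₂, -, hg⟩
  exact hg ⟨MetricCoord.isPureGaugeOn_empty Z h₁, MetricCoord.isPureGaugeOn_empty Z h₂⟩

end Main

end Literature.Geometry.Lorentzian

end
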